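import Literature.Geometry.Riemannian.CurvatureScale
import Literature.Geometry.Riemannian.ParabolicNhdComparisonChain
import HarnessLib

/-!
# Point picking with curvature control on a conventional neighbourhood (Bamler 2020a, §10.2,
# first half of the proof of the ε-regularity Thm. 10.2)

R. Bamler, *Entropy and heat kernel bounds on a Ricci flow background*, arXiv:2008.07093 (2020a),
§10.2, proof of Thm. 10.2 (arXiv v1 Thm. 39): after the point-picking Claim (arXiv v1 Claim 42:
`(x', t') ∈ P*⁻(x, t; 10 A r_Rm(x,t))` with `r_Rm(x',t') ≤ r_Rm(x,t)` and `r_Rm ≥ r_Rm(x',t')/10`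
on `P*⁻(x', t'; A r_Rm(x',t'))`), "By Corollary 9.6, we can find a sequence `A'ᵢ ≤ Aᵢ`, `A'ᵢ → ∞`
such that `P⁻(x'ᵢ, t'ᵢ; A'ᵢ r'ᵢ) ⊂ P*⁻(x'ᵢ, t'ᵢ; Aᵢ r'ᵢ)`, which implies that `r_Rm ≥ r'ᵢ/10` on
`P⁻(x'ᵢ, t'ᵢ; A'ᵢ r'ᵢ)`." We prove this combination in quantified form
(`exists_point_picking_conventional`): given the desired conventional size `(A₁, T⁻₁)` there is
an `A` for the Claim such that the picked point has `ρ ≥ ρ'/10` (`ρ = min(r_Rm, 1)`) on the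
conventional backward neighbourhood `P(x', t'; A₁ ρ'/20, −T⁻₁ (ρ'/20)²)` — from the Claim for the
truncated scale (`exists_point_picking_truncCurvatureScale`), the Ricci bound below the scale
(`CurvatureScaleAdmissible.abs_ricci_le`) and the chained Cor. 9.6 (a)
(`exists_mem_pParabolicNhd_of_ricci_bound_chain`). This is the geometric input of the blow-up
argument; the remaining steps of Thm. 10.2 (limits of flows, rigidity of the shrinking soliton,
pseudolocality) are not in the tree. Everything here is proved; no definitions, no named facts.

## References

* R. H. Bamler, *Entropy and heat kernel bounds on a Ricci flow background*, arXiv:2008.07093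
  (2020), §10.2, proof of Thm. 10.2 (arXiv v1 Thm. 39, Claim 42). [Bamler2020Entropy]
-/

noncomputable section

open Set Filter Function
open scoped Manifold ContDiff Topology ENNReal NNReal

namespace Literature.Geometry.Riemannian

open Lorentzian Lorentzian.PseudoRiemannianMetric

universe u


section Pointwise

variable {m : ℕ} {M : Type u} [TopologicalSpace M] [ChartedSpace (EuclideanSpace ℝ (Fin m)) M]
  [IsManifold 𝓘(ℝ, EuclideanSpace ℝ (Fin m)) ∞ M]
  {h : ℝ → PseudoRiemannianMetric 𝓘(ℝ, EuclideanSpace ℝ (Fin m)) ∞ (EuclideanSpace ℝ (Fin m))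
    (TangentSpace 𝓘(ℝ, EuclideanSpace ℝ (Fin m)) : M → Type _)}
  {cov : ℝ → CovariantDerivative 𝓘(ℝ, EuclideanSpace ℝ (Fin m)) (EuclideanSpace ℝ (Fin m))
    (TangentSpace 𝓘(ℝ, EuclideanSpace ℝ (Fin m)) : M → Type _)}
  {S : Set ℝ} {hR : ∀ s, (h s).IsRiemannian}

/-- **A lower bound on the truncated scale is a pointwise curvature bound**: if `0 < r < ρ(y, s)`
and `s ∈ S`, then `|Rm_{g_s}|(y) ≤ r⁻²` in the frame sense (the point `(y, s)` lies in its own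
conventional neighbourhood `P(y, s; r)`, on which `|Rm| ≤ r⁻²` by admissibility). This is how
"`r_Rm ≥ r'/10` on `P⁻(x', t'; A' r')`" is consumed as a curvature bound in the blow-up argument.
[cite: Bamler2020Entropy, §10.1, Def. 10.1; §10.2, proof of Thm. 10.2] -/
theorem curvatureBoundedOn_singleton_of_lt_truncCurvatureScale {y : M} {s r : ℝ} (hs : s ∈ S)
    (hr : 0 < r) (hlt : r < truncCurvatureScale h cov S hR y s) :
    CurvatureBoundedOn (h s) (cov s) {y} (r ^ 2)⁻¹ := by
  have hadm := curvatureScaleAdmissible_of_lt_truncCurvatureScale hr hlt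
  have hsI : s ∈ Icc (s - r ^ 2) (s + r ^ 2) ∩ S :=
    ⟨⟨by nlinarith [sq_nonneg r], by nlinarith [sq_nonneg r]⟩, hs⟩
  refine (hadm.2 s hsI).mono (fun z hz ↦ ?_) le_rfl
  rw [mem_singleton_iff.1 hz, mem_setOf_eq, PseudoRiemannianMetric.edist_self]
  exact ENNReal.ofReal_pos.2 hr

end Pointwise

/-- **Curvature control on a conventional backward parabolic neighbourhood of the picked point**
(Bamler 2020a, §10.2, proof of Thm. 10.2 / arXiv v1 Thm. 39, the step "By Corollary 9.6 we can
find `A'ᵢ → ∞` such that `P⁻(x'ᵢ, t'ᵢ; A'ᵢ r'ᵢ) ⊂ P*⁻(x'ᵢ, t'ᵢ; Aᵢ r'ᵢ)`, which implies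
`r_Rm ≥ r'ᵢ/10` on `P⁻(x'ᵢ, t'ᵢ; A'ᵢ r'ᵢ)`"): for `m ≥ 3`, `A₁ ≥ 0`, `T⁻₁ ≥ 1` there is `A ≥ 1`
such that on every Ricci flow of Riemannian metrics on a closed connected `m`-manifold over
`[a, T]`, for every `(x, t)` with `a ≤ t − 200 A²` the point `(x', t')` picked by
`exists_point_picking_truncCurvatureScale` (with `ρ = min(r_Rm, 1)`, `ρ' := ρ(x', t')`) satisfies,
besides `(x',t') ∈ P*⁻((x,t); 10 A ρ(x,t))`, `ρ' ≤ ρ(x,t)` and `ρ ≥ ρ'/10` on `P*⁻((x',t'); A ρ')`,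
the CONVENTIONAL conclusion: `ρ(y, s) ≥ ρ'/10` for all `(y, s)` with
`s ∈ [t' − T⁻₁ (ρ'/20)², t']` and `d_{t'}(x', y) < A₁ ρ'/20` — by the chained Cor. 9.6 (a)
(`exists_mem_pParabolicNhd_of_ricci_bound_chain` at scale `r = ρ'/20` with `K = m`, whose
hypothesis holds because `ρ ≥ ρ'/10 > r` on the `P*`-ball gives `|Ric| ≤ m r⁻²` on the unit-scale
conventional neighbourhoods of its points, `CurvatureScaleAdmissible.abs_ricci_le`).
[cite: Bamler2020Entropy, §10.2, proof of Thm. 10.2 (arXiv v1 Thm. 39), Claim 42 and the following paragraph] -/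
theorem exists_point_picking_conventional (m : ℕ) (hm : 3 ≤ m) {A₁ Tm₁ : ℝ} (hA₁ : 0 ≤ A₁)
    (hTm₁ : 1 ≤ Tm₁) :
    ∃ A : ℝ, 1 ≤ A ∧ ∀ {M : Type u} [TopologicalSpace M] [ChartedSpace (EuclideanSpace ℝ (Fin m)) M]
      [IsManifold 𝓘(ℝ, EuclideanSpace ℝ (Fin m)) ∞ M] [T2Space M] [CompactSpace M]
      [SecondCountableTopology M] [MeasurableSpace M] [BorelSpace M] [ConnectedSpace M] [T3Space M]
      {h : ℝ → PseudoRiemannianMetric 𝓘(ℝ, EuclideanSpace ℝ (Fin m)) ∞ (EuclideanSpace ℝ (Fin m))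
        (TangentSpace 𝓘(ℝ, EuclideanSpace ℝ (Fin m)) : M → Type _)}
      {cov : ℝ → CovariantDerivative 𝓘(ℝ, EuclideanSpace ℝ (Fin m)) (EuclideanSpace ℝ (Fin m))
        (TangentSpace 𝓘(ℝ, EuclideanSpace ℝ (Fin m)) : M → Type _)}
      {a T : ℝ} (hflow : IsRicciFlow h cov (Icc a T)) (hh : IsContMDiffFamilyOn ∞ h univ)
      (hR : ∀ s, (h s).IsRiemannian) {t : ℝ} (ht : t ∈ Icc a T) (x : M), a ≤ t - 200 * A ^ 2 →
      ∃ (t' : ℝ) (ht' : t' ∈ Icc a T) (x' : M)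
        (hx : t - (10 * A * truncCurvatureScale h cov (Icc a T) hR x t) ^ 2 ∈ Icc a T)
        (hx' : t' - (A * truncCurvatureScale h cov (Icc a T) hR x' t') ^ 2 ∈ Icc a T),
        (⟨⟨t', ht'⟩, x'⟩ : (ricciFlowMetricFlow hh hR Set.ordConnected_Icc hflow).Pt) ∈
          (ricciFlowMetricFlow hh hR Set.ordConnected_Icc hflow).pParabolicBallBwd ⟨⟨t, ht⟩, x⟩
            (10 * A * truncCurvatureScale h cov (Icc a T) hR x t) hx ∧
        truncCurvatureScale h cov (Icc a T) hR x' t' ≤ truncCurvatureScale h cov (Icc a T) hR x t ∧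
        (∀ (s : ℝ) (hs : s ∈ Icc a T) (y : M),
          (⟨⟨s, hs⟩, y⟩ : (ricciFlowMetricFlow hh hR Set.ordConnected_Icc hflow).Pt) ∈
            (ricciFlowMetricFlow hh hR Set.ordConnected_Icc hflow).pParabolicBallBwd ⟨⟨t', ht'⟩, x'⟩
              (A * truncCurvatureScale h cov (Icc a T) hR x' t') hx' →
          truncCurvatureScale h cov (Icc a T) hR x' t' / 10 ≤
            truncCurvatureScale h cov (Icc a T) hR y s) ∧
        ∀ s ∈ Icc a T,
          t' - Tm₁ * (truncCurvatureScale h cov (Icc a T) hR x' t' / 20) ^ 2 ≤ s → s ≤ t' →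
          ∀ y : M, (h t').edist (hR t') x' y <
            ENNReal.ofReal (A₁ * (truncCurvatureScale h cov (Icc a T) hR x' t' / 20)) →
          truncCurvatureScale h cov (Icc a T) hR x' t' / 10 ≤
            truncCurvatureScale h cov (Icc a T) hR y s := by
  have hm0 : 0 < m := lt_of_lt_of_le (by norm_num) hm
  -- the chain constant at `K = m`
  obtain ⟨A₂, hA₂, hchain⟩ := exists_mem_pParabolicNhd_of_ricci_bound_chain m hm (K := m)
    (Nat.cast_nonneg m) hA₁ hTm₁
  set A : ℝ := max (A₂ / 20) (max (Real.sqrt Tm₁ / 20) 1) with hAdef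
  have hA1 : 1 ≤ A := le_trans (le_max_right _ _) (le_max_right _ _)
  have hA0 : 0 < A := one_pos.trans_le hA1
  have hA₂A : A₂ ≤ 20 * A := by
    have : A₂ / 20 ≤ A := le_max_left _ _
    linarith
  have hTmA : Tm₁ ≤ 400 * A ^ 2 := by
    have h1 : Real.sqrt Tm₁ / 20 ≤ A := le_trans (le_max_left _ _) (le_max_right _ _)
    have h2 : Real.sqrt Tm₁ ≤ 20 * A := by linarith
    have h3 : Tm₁ = Real.sqrt Tm₁ ^ 2 := (Real.sq_sqrt (by linarith)).symm
    rw [h3]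
    nlinarith [Real.sqrt_nonneg Tm₁]
  refine ⟨A, hA1, ?_⟩
  intro M _ _ _ _ _ _ _ _ _ _ h cov a T hflow hh hR t ht x hat
  obtain ⟨t', ht', x', hx, hx', hmem, hle, hmax⟩ :=
    exists_point_picking_truncCurvatureScale hm0 hflow hh hR hA0 ht x hat
  refine ⟨t', ht', x', hx, hx', hmem, hle, hmax, ?_⟩
  intro s hs h1s h2s y hy
  -- notation
  set 𝒳 : MetricFlow (Icc a T) := ricciFlowMetricFlow hh hR Set.ordConnected_Icc hflow with h𝒳
  have hH := ricciFlowMetricFlow_isHConcentrated hm0 hh hR Set.ordConnected_Icc hflow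
  set ρ' : ℝ := truncCurvatureScale h cov (Icc a T) hR x' t' with hρ'
  set ρ₀ : ℝ := truncCurvatureScale h cov (Icc a T) hR x t with hρ₀
  -- `0 < ρ' ≤ 1`, `ρ₀ ≤ 1`
  obtain ⟨c₀, hc₀, hc₀le⟩ := exists_pos_ofReal_le_curvatureScale hflow hR
  have hρ'pos : 0 < ρ' := by
    have := le_truncCurvatureScale ((hc₀le x' t').1.anti (lt_min hc₀ one_pos) (min_le_left _ _))
      (min_le_right _ _)
    exact (lt_min hc₀ one_pos).trans_le this
  have hρ'1 : ρ' ≤ 1 := truncCurvatureScale_le_one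
  have hρ₀1 : ρ₀ ≤ 1 := truncCurvatureScale_le_one
  have hρ₀0 : 0 ≤ ρ₀ := ENNReal.toReal_nonneg
  set r : ℝ := ρ' / 20 with hr
  have hr0 : 0 < r := by positivity
  -- the times of `(x', t')`
  have ht't : t - (10 * A * ρ₀) ^ 2 ≤ t' ∧ t' ≤ t := by
    have h1 := (MetricFlow.mem_pParabolicNhd_iff.1 hmem).1
    exact ⟨h1.1, by simpa using h1.2⟩
  -- room below
  have hroom : a < t' - (Tm₁ + 1) * r ^ 2 := by
    have h1 : (10 * A * ρ₀) ^ 2 ≤ 100 * A ^ 2 := by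
      have : ρ₀ ^ 2 ≤ 1 := by nlinarith
      nlinarith [sq_nonneg A]
    have h2 : (Tm₁ + 1) * r ^ 2 ≤ A ^ 2 + 1 / 400 := by
      have : r ^ 2 ≤ 1 / 400 := by rw [hr]; nlinarith
      have : (Tm₁ + 1) * r ^ 2 ≤ (400 * A ^ 2 + 1) * (1 / 400) :=
        mul_le_mul (by linarith) this (sq_nonneg _) (by positivity)
      linarith
    nlinarith
  have hb : t' - Tm₁ * r ^ 2 ∈ Icc a T := by
    constructor
    · have : Tm₁ * r ^ 2 ≤ (Tm₁ + 1) * r ^ 2 := by nlinarith [sq_nonneg r]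
      linarith
    · have : 0 ≤ Tm₁ * r ^ 2 := by positivity
      linarith [ht'.2]
  -- the chain region lies in the `P*`-ball of the picked point
  have hsub : 𝒳.pParabolicNhd ⟨⟨t', ht'⟩, x'⟩ (A₂ * r) (Tm₁ * r ^ 2) 0 hb ⊆
      𝒳.pParabolicBallBwd ⟨⟨t', ht'⟩, x'⟩ (A * ρ') hx' := by
    refine hH.pParabolicNhd_mono _ ?_ (by positivity) ?_ le_rfl hb hx'
    · rw [hr]; nlinarith
    · rw [hr]; nlinarith [sq_nonneg ρ']
  -- hypothesis (H) of the chain theorem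
  have hHyp : ∀ (s₁ : ℝ) (hs₁ : s₁ ∈ Icc a T) (y₁ : M),
      (⟨⟨s₁, hs₁⟩, y₁⟩ : 𝒳.Pt) ∈ 𝒳.pParabolicNhd ⟨⟨t', ht'⟩, x'⟩ (A₂ * r) (Tm₁ * r ^ 2) 0 hb →
      ∀ τ ∈ Icc (s₁ - r ^ 2) s₁, ∀ z : M, (h s₁).edist (hR s₁) y₁ z < ENNReal.ofReal r →
      ∀ v : TangentSpace 𝓘(ℝ, EuclideanSpace ℝ (Fin m)) z,
        |(cov τ).ricci z v v| ≤ (m : ℝ) / r ^ 2 * (h τ).val z v v := by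
    intro s₁ hs₁ y₁ hy₁ τ hτ z hz v
    have hρy : ρ' / 10 ≤ truncCurvatureScale h cov (Icc a T) hR y₁ s₁ := hmax s₁ hs₁ y₁ (hsub hy₁)
    have hadm : CurvatureScaleAdmissible h cov (Icc a T) hR y₁ s₁ r :=
      curvatureScaleAdmissible_of_lt_truncCurvatureScale hr0 (by rw [hr]; linarith)
    have hτI : τ ∈ Icc (s₁ - r ^ 2) (s₁ + r ^ 2) ∩ Icc a T := by
      have hs₁t : t' - Tm₁ * r ^ 2 ≤ s₁ := (MetricFlow.mem_pParabolicNhd_iff.1 hy₁).1.1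
      refine ⟨⟨hτ.1, by nlinarith [hτ.2, sq_nonneg r]⟩, ?_, hτ.2.trans hs₁.2⟩
      nlinarith [hτ.1, sq_nonneg r]
    have := hadm.abs_ricci_le hτI hz v
    rwa [div_eq_mul_inv] 
  -- apply the chain theorem to `(y, s)`
  have hys : (⟨⟨s, hs⟩, y⟩ : 𝒳.Pt) ∈ 𝒳.pParabolicNhd ⟨⟨t', ht'⟩, x'⟩ (A₂ * r) (Tm₁ * r ^ 2) 0 hb :=
    hchain hflow hh hR ht' hb hr0 hroom x' hHyp hs h1s h2s y hy
  exact hmax s hs y (hsub hys)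

end Literature.Geometry.Riemannian

end
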